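import Literature.NumberTheory.Automorphic.QuaternionFiniteAdeleSinglePlaceReduction
import HarnessLib

/-!
# Gluing local data in `ℍ[𝔸_K^∞,a,b]`: elements and units with prescribed local components

Topic `NumberTheory/Automorphic`; theorems and auxiliary definitions only (no named fact).
Sixth companion file of `QuaternionCoordOrder` on the way from its named fact
`QuaternionAlgebra.coordOrder_heckeDoubleCoset` to Kneser's strong approximation theorem
(Vignéras, LNM 800, Ch. III §4 Thm. 4.3): bookkeeping in the restricted product
`H_A = ∏'_w H_w` (Vignéras III §1) for the coordinate model `ℍ[𝔸_K^∞,a,b]` of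
`QuaternionCoordOrderAdelicLiftProofs` / `QuaternionFiniteAdeleSinglePlaceReduction`.

* `ofLocal S f` : the element of `ℍ[𝔸_K^∞,a,b]` with local components `f w` at `w ∈ S` (a finite
  set of places) and `1` elsewhere (`localComp_ofLocal_of_mem`, `localComp_ofLocal_of_not_mem`);
  it is multiplicative in `f` (`ofLocal_mul`), so local units glue to a unit `ofLocalUnits S x` of
  `ℍ[𝔸_K^∞,a,b]` (the element `x = (x_w) ∈ H_A^×` with `x_w = 1` for almost all `w` of Vignéras's
  proof of Thm. 4.3);
* `localComp_toFiniteAdele` : the local component at `w` of the diagonal image `ι(y)` is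
  `ι_w(y) ∈ ℍ[K_w,a,b]`;
* `mem_coordBox_of_forall_localComp` : an element lies in the coordinate box of an ideal
  neighbourhood `{t : |t_w| ≤ |𝔫|_w ∀ w}` as soon as all its local components do
  (place by place control of closeness, `FiniteAdeleRing.exists_forall_valued_le_idealRadius_imp_mem`).

## References

* M.-F. Vignéras, *Arithmétique des algèbres de quaternions*, LNM 800 (1980), Ch. III §1
  (adèles: produit restreint) and §4 (proof of Thm. 4.3) [VignerasLNM800].
-/

noncomputable section

open scoped Quaternion Pointwise
open NumberField IsDedekindDomain

namespace Literature.NumberTheory.Automorphic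

namespace QuaternionAlgebra

/-- `ℍ⟮K; R; a, b⟯ := ℍ[K, algebraMap R K a, algebraMap R K b]` (file-local notation, as in
`QuaternionCoordOrder`). -/
local notation "ℍ⟮" K "; " R "; " a ", " b "⟯" =>
  QuaternionAlgebra K (algebraMap R K a) (0 : K) (algebraMap R K b)

variable {K : Type} [Field K] [NumberField K] (a b : 𝓞 K)

/-- `𝔸_K^∞`. -/
local notation "𝔸ᶠ" => FiniteAdeleRing (𝓞 K) K

/-- `K_w`. -/
local notation "K_" w => HeightOneSpectrum.adicCompletion K w

/-- `𝒪_w`. -/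
local notation "𝒪_" w => HeightOneSpectrum.adicCompletionIntegers K w

/-! ### Elements with prescribed local components -/

/-- **Gluing local components**: the element of `ℍ[𝔸_K^∞,a,b]` whose local component is `f w` at
the places `w ∈ S` and `1` at the places outside the finite set `S` (an element of the restricted
product `∏'_w H_w`, Vignéras III §1). [cite: VignerasLNM800, Ch. III §1 (adèles)] -/
def ofLocal (S : Finset (HeightOneSpectrum (𝓞 K)))
    (f : (w : HeightOneSpectrum (𝓞 K)) →
      ℍ⟮K_ w; 𝒪_ w; algebraMap (𝓞 K) (𝒪_ w) a, algebraMap (𝓞 K) (𝒪_ w) b⟯) : ℍ⟮𝔸ᶠ; 𝓞 K; a, b⟯ :=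
  ⟨1 + ∑ u ∈ S, finiteAdeleSingleHom K u ((f u).re - 1), ∑ u ∈ S, finiteAdeleSingleHom K u (f u).imI,
    ∑ u ∈ S, finiteAdeleSingleHom K u (f u).imJ, ∑ u ∈ S, finiteAdeleSingleHom K u (f u).imK⟩

/-- The local component of `ofLocal S f` at `u ∈ S` is `f u`. [folklore] -/
theorem localComp_ofLocal_of_mem {S : Finset (HeightOneSpectrum (𝓞 K))}
    (f : (w : HeightOneSpectrum (𝓞 K)) →
      ℍ⟮K_ w; 𝒪_ w; algebraMap (𝓞 K) (𝒪_ w) a, algebraMap (𝓞 K) (𝒪_ w) b⟯)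
    {u : HeightOneSpectrum (𝓞 K)} (hu : u ∈ S) : localComp a b u (ofLocal a b S f) = f u := by
  refine _root_.QuaternionAlgebra.ext ?_ ?_ ?_ ?_ <;> simp only [ofLocal, localComp_re,
    localComp_imI, localComp_imJ, localComp_imK, FiniteAdeleRing.add_apply',
    FiniteAdeleRing.coe_one_apply, sum_finiteAdeleSingleHom_apply_of_mem _ hu, add_sub_cancel]

/-- The local component of `ofLocal S f` at `u ∉ S` is `1`. [folklore] -/
theorem localComp_ofLocal_of_not_mem {S : Finset (HeightOneSpectrum (𝓞 K))}
    (f : (w : HeightOneSpectrum (𝓞 K)) →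
      ℍ⟮K_ w; 𝒪_ w; algebraMap (𝓞 K) (𝒪_ w) a, algebraMap (𝓞 K) (𝒪_ w) b⟯)
    {u : HeightOneSpectrum (𝓞 K)} (hu : u ∉ S) : localComp a b u (ofLocal a b S f) = 1 := by
  refine _root_.QuaternionAlgebra.ext ?_ ?_ ?_ ?_ <;> simp only [ofLocal, localComp_re,
    localComp_imI, localComp_imJ, localComp_imK, FiniteAdeleRing.add_apply',
    FiniteAdeleRing.coe_one_apply, sum_finiteAdeleSingleHom_apply_of_not_mem _ hu, add_zero,
    _root_.QuaternionAlgebra.re_one, _root_.QuaternionAlgebra.imI_one,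
    _root_.QuaternionAlgebra.imJ_one, _root_.QuaternionAlgebra.imK_one]

/-- Gluing is multiplicative: `ofLocal S f * ofLocal S f' = ofLocal S (f f')`. [folklore] -/
theorem ofLocal_mul (S : Finset (HeightOneSpectrum (𝓞 K)))
    (f f' : (w : HeightOneSpectrum (𝓞 K)) →
      ℍ⟮K_ w; 𝒪_ w; algebraMap (𝓞 K) (𝒪_ w) a, algebraMap (𝓞 K) (𝒪_ w) b⟯) :
    ofLocal a b S f * ofLocal a b S f' = ofLocal a b S (fun w => f w * f' w) := by
  refine eq_of_localComp_eq a b fun u => ?_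
  rw [localComp_mul]
  by_cases hu : u ∈ S
  · rw [localComp_ofLocal_of_mem a b _ hu, localComp_ofLocal_of_mem a b _ hu,
      localComp_ofLocal_of_mem a b _ hu]
  · rw [localComp_ofLocal_of_not_mem a b _ hu, localComp_ofLocal_of_not_mem a b _ hu,
      localComp_ofLocal_of_not_mem a b _ hu, one_mul]

/-- Gluing the constant family `1` gives `1`. [folklore] -/
theorem ofLocal_one (S : Finset (HeightOneSpectrum (𝓞 K))) :
    ofLocal a b S (fun _ => 1) = (1 : ℍ⟮𝔸ᶠ; 𝓞 K; a, b⟯) := by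
  refine eq_of_localComp_eq a b fun u => ?_
  rw [localComp_one]
  by_cases hu : u ∈ S
  · exact localComp_ofLocal_of_mem a b _ hu
  · exact localComp_ofLocal_of_not_mem a b _ hu

/-- **Gluing local units**: the unit of `ℍ[𝔸_K^∞,a,b]` with local components the units `x w` at
`w ∈ S` and `1` elsewhere (the adelic element `x = (x_w)`, `x_w = 1` p.p., of Vignéras's proof
of Thm. III.4.3). [cite: VignerasLNM800, Ch. III §1 (groupe des unités de `H_A`) and §4] -/
def ofLocalUnits (S : Finset (HeightOneSpectrum (𝓞 K)))
    (x : (w : HeightOneSpectrum (𝓞 K)) →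
      (ℍ⟮K_ w; 𝒪_ w; algebraMap (𝓞 K) (𝒪_ w) a, algebraMap (𝓞 K) (𝒪_ w) b⟯)ˣ) :
    (ℍ⟮𝔸ᶠ; 𝓞 K; a, b⟯)ˣ where
  val := ofLocal a b S fun w => (x w : ℍ⟮K_ w; 𝒪_ w; algebraMap (𝓞 K) (𝒪_ w) a,
    algebraMap (𝓞 K) (𝒪_ w) b⟯)
  inv := ofLocal a b S fun w => ((x w)⁻¹ : (ℍ⟮K_ w; 𝒪_ w; algebraMap (𝓞 K) (𝒪_ w) a,
    algebraMap (𝓞 K) (𝒪_ w) b⟯)ˣ)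
  val_inv := by
    rw [ofLocal_mul]
    simp only [Units.mul_inv]
    exact ofLocal_one a b S
  inv_val := by
    rw [ofLocal_mul]
    simp only [Units.inv_mul]
    exact ofLocal_one a b S

/-- Local components of the glued unit: `x u` at `u ∈ S`. [folklore] -/
theorem localComp_ofLocalUnits_of_mem {S : Finset (HeightOneSpectrum (𝓞 K))}
    (x : (w : HeightOneSpectrum (𝓞 K)) →
      (ℍ⟮K_ w; 𝒪_ w; algebraMap (𝓞 K) (𝒪_ w) a, algebraMap (𝓞 K) (𝒪_ w) b⟯)ˣ)
    {u : HeightOneSpectrum (𝓞 K)} (hu : u ∈ S) :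
    localComp a b u (ofLocalUnits a b S x : ℍ⟮𝔸ᶠ; 𝓞 K; a, b⟯) = x u :=
  localComp_ofLocal_of_mem a b _ hu

/-- Local components of the glued unit: `1` at `u ∉ S`. [folklore] -/
theorem localComp_ofLocalUnits_of_not_mem {S : Finset (HeightOneSpectrum (𝓞 K))}
    (x : (w : HeightOneSpectrum (𝓞 K)) →
      (ℍ⟮K_ w; 𝒪_ w; algebraMap (𝓞 K) (𝒪_ w) a, algebraMap (𝓞 K) (𝒪_ w) b⟯)ˣ)
    {u : HeightOneSpectrum (𝓞 K)} (hu : u ∉ S) :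
    localComp a b u (ofLocalUnits a b S x : ℍ⟮𝔸ᶠ; 𝓞 K; a, b⟯) = 1 :=
  localComp_ofLocal_of_not_mem a b _ hu

/-- Local components of the inverse of the glued unit: `(x u)⁻¹` at `u ∈ S`. [folklore] -/
theorem localComp_ofLocalUnits_inv_of_mem {S : Finset (HeightOneSpectrum (𝓞 K))}
    (x : (w : HeightOneSpectrum (𝓞 K)) →
      (ℍ⟮K_ w; 𝒪_ w; algebraMap (𝓞 K) (𝒪_ w) a, algebraMap (𝓞 K) (𝒪_ w) b⟯)ˣ)
    {u : HeightOneSpectrum (𝓞 K)} (hu : u ∈ S) :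
    localComp a b u ((ofLocalUnits a b S x)⁻¹ : (ℍ⟮𝔸ᶠ; 𝓞 K; a, b⟯)ˣ) =
      ((x u)⁻¹ : (ℍ⟮K_ u; 𝒪_ u; algebraMap (𝓞 K) (𝒪_ u) a, algebraMap (𝓞 K) (𝒪_ u) b⟯)ˣ) :=
  localComp_ofLocal_of_mem a b _ hu

/-- Local components of the inverse of the glued unit: `1` at `u ∉ S`. [folklore] -/
theorem localComp_ofLocalUnits_inv_of_not_mem {S : Finset (HeightOneSpectrum (𝓞 K))}
    (x : (w : HeightOneSpectrum (𝓞 K)) →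
      (ℍ⟮K_ w; 𝒪_ w; algebraMap (𝓞 K) (𝒪_ w) a, algebraMap (𝓞 K) (𝒪_ w) b⟯)ˣ)
    {u : HeightOneSpectrum (𝓞 K)} (hu : u ∉ S) :
    localComp a b u ((ofLocalUnits a b S x)⁻¹ : (ℍ⟮𝔸ᶠ; 𝓞 K; a, b⟯)ˣ) = 1 :=
  localComp_ofLocal_of_not_mem a b _ hu

/-- **Conjugating by a glued unit, place by place**: the local component at `u ∈ S` of `h z h⁻¹`,
`h = ofLocalUnits S x`, is `x_u z_u x_u⁻¹`. [folklore] -/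
theorem localComp_ofLocalUnits_conj_of_mem {S : Finset (HeightOneSpectrum (𝓞 K))}
    (x : (w : HeightOneSpectrum (𝓞 K)) →
      (ℍ⟮K_ w; 𝒪_ w; algebraMap (𝓞 K) (𝒪_ w) a, algebraMap (𝓞 K) (𝒪_ w) b⟯)ˣ)
    (z : ℍ⟮𝔸ᶠ; 𝓞 K; a, b⟯) {u : HeightOneSpectrum (𝓞 K)} (hu : u ∈ S) :
    localComp a b u ((ofLocalUnits a b S x : ℍ⟮𝔸ᶠ; 𝓞 K; a, b⟯) * z *
      ((ofLocalUnits a b S x)⁻¹ : (ℍ⟮𝔸ᶠ; 𝓞 K; a, b⟯)ˣ)) =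
      (x u : ℍ⟮K_ u; 𝒪_ u; algebraMap (𝓞 K) (𝒪_ u) a, algebraMap (𝓞 K) (𝒪_ u) b⟯) *
        localComp a b u z * ((x u)⁻¹ : (ℍ⟮K_ u; 𝒪_ u; algebraMap (𝓞 K) (𝒪_ u) a,
          algebraMap (𝓞 K) (𝒪_ u) b⟯)ˣ) := by
  rw [localComp_mul, localComp_mul, localComp_ofLocalUnits_of_mem a b x hu,
    localComp_ofLocalUnits_inv_of_mem a b x hu]

/-- Conjugating by a glued unit does nothing at the places `u ∉ S`. [folklore] -/
theorem localComp_ofLocalUnits_conj_of_not_mem {S : Finset (HeightOneSpectrum (𝓞 K))}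
    (x : (w : HeightOneSpectrum (𝓞 K)) →
      (ℍ⟮K_ w; 𝒪_ w; algebraMap (𝓞 K) (𝒪_ w) a, algebraMap (𝓞 K) (𝒪_ w) b⟯)ˣ)
    (z : ℍ⟮𝔸ᶠ; 𝓞 K; a, b⟯) {u : HeightOneSpectrum (𝓞 K)} (hu : u ∉ S) :
    localComp a b u ((ofLocalUnits a b S x : ℍ⟮𝔸ᶠ; 𝓞 K; a, b⟯) * z *
      ((ofLocalUnits a b S x)⁻¹ : (ℍ⟮𝔸ᶠ; 𝓞 K; a, b⟯)ˣ)) = localComp a b u z := by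
  rw [localComp_mul, localComp_mul, localComp_ofLocalUnits_of_not_mem a b x hu,
    localComp_ofLocalUnits_inv_of_not_mem a b x hu, one_mul, mul_one]

/-- Local components are additive: `(y - z)_u = y_u - z_u`. [folklore] -/
theorem localComp_sub (y z : ℍ⟮𝔸ᶠ; 𝓞 K; a, b⟯) (u : HeightOneSpectrum (𝓞 K)) :
    localComp a b u (y - z) = localComp a b u y - localComp a b u z := by
  refine _root_.QuaternionAlgebra.ext ?_ ?_ ?_ ?_ <;> simp only [localComp_re, localComp_imI,
    localComp_imJ, localComp_imK, _root_.QuaternionAlgebra.re_sub,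
    _root_.QuaternionAlgebra.imI_sub, _root_.QuaternionAlgebra.imJ_sub,
    _root_.QuaternionAlgebra.imK_sub, FiniteAdeleRing.sub_apply']

/-! ### Local components of the diagonal image -/

/-- **The local component at `w` of `ι(y)` is `ι_w(y)`** (`toAdicCompletion`): the `w`-component of
the finite adele of `k ∈ K` is `k ∈ K_w`. [cite: VignerasLNM800, Ch. III §1 (plongement diagonal)] -/
theorem localComp_toFiniteAdele (w : HeightOneSpectrum (𝓞 K)) (y : ℍ⟮K; 𝓞 K; a, b⟯) :
    localComp a b w (toFiniteAdele a b y) = toAdicCompletion a b w y := by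
  rw [toAdicCompletion_apply]
  refine _root_.QuaternionAlgebra.ext ?_ ?_ ?_ ?_ <;>
    simp only [localComp_re, localComp_imI, localComp_imJ, localComp_imK, toFiniteAdele_apply,
      algebraMap_finiteAdele_apply]

/-- The reduced trace of `ι_w(y)` is the image of that of `y`: `2 ι_w(y)₀ = (2 y₀ : K) ∈ K_w`.
[folklore] -/
theorem two_mul_re_toAdicCompletion (w : HeightOneSpectrum (𝓞 K)) (y : ℍ⟮K; 𝓞 K; a, b⟯) :
    2 * (toAdicCompletion a b w y).re = algebraMap K (K_ w) (2 * y.re) := by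
  rw [toAdicCompletion_apply, map_mul, map_ofNat]

omit [NumberField K] in
/-- If `y + ȳ = t` (`t ∈ K`) then `2 y₀ = t`. [folklore] -/
theorem two_mul_re_eq_of_add_star_eq {y : ℍ⟮K; 𝓞 K; a, b⟯} {t : K}
    (h : y + star y = algebraMap K ℍ⟮K; 𝓞 K; a, b⟯ t) : 2 * y.re = t := by
  have h' := congrArg _root_.QuaternionAlgebra.re h
  rw [_root_.QuaternionAlgebra.algebraMap_eq] at h'
  simp only [_root_.QuaternionAlgebra.re_add, _root_.QuaternionAlgebra.re_star, zero_mul,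
    add_zero] at h'
  linear_combination h'

/-! ### Closeness place by place -/

/-- **Box membership from local components.** If the open set `V ⊆ 𝔸_K^∞` contains the ideal box
of `𝔫` (`|t_u| ≤ |𝔫|_u` for all `u`, `FiniteAdeleRing.exists_forall_valued_le_idealRadius_imp_mem`)
and every local component of `q` has its four coordinates of valuation `≤ |𝔫|_u`, then `q` lies in
the coordinate box of `V`. [folklore] -/
theorem mem_coordBox_of_forall_localComp {V : Set 𝔸ᶠ} {𝔫 : Ideal (𝓞 K)}
    (hbox : ∀ c : 𝔸ᶠ, (∀ u, Valued.v (c u) ≤ idealRadius K u 𝔫) → c ∈ V)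
    {q : ℍ⟮𝔸ᶠ; 𝓞 K; a, b⟯}
    (h : ∀ u, Valued.v (localComp a b u q).re ≤ idealRadius K u 𝔫 ∧
      Valued.v (localComp a b u q).imI ≤ idealRadius K u 𝔫 ∧
      Valued.v (localComp a b u q).imJ ≤ idealRadius K u 𝔫 ∧
      Valued.v (localComp a b u q).imK ≤ idealRadius K u 𝔫) :
    q ∈ coordBox a b V :=
  ⟨hbox _ fun u => (h u).1, hbox _ fun u => (h u).2.1, hbox _ fun u => (h u).2.2.1,
    hbox _ fun u => (h u).2.2.2⟩

/-- A coordinate of valuation `≤ 1` at a place not dividing `𝔫 ≠ 0` is within the box radius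
there (`|𝔫|_u = 1`). [folklore] -/
theorem valued_le_idealRadius_of_not_dvd {𝔫 : Ideal (𝓞 K)} (h𝔫 : 𝔫 ≠ 0)
    {u : HeightOneSpectrum (𝓞 K)} (hu : ¬ u.asIdeal ∣ 𝔫) {c : K_ u} (hc : Valued.v c ≤ 1) :
    Valued.v c ≤ idealRadius K u 𝔫 := by
  rw [idealRadius_eq_one_of_not_dvd h𝔫 hu]
  exact hc

/-- The difference of two elements all of whose coordinates have valuation `≤ 1` has coordinates
of valuation `≤ 1` (`𝒪_u` is a ring). [folklore] -/
theorem valued_sub_le_one {u : HeightOneSpectrum (𝓞 K)} {c₁ c₃ : K_ u} {p q : ℍ[K_ u, c₁, c₃]}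
    (hp : Valued.v p.re ≤ 1 ∧ Valued.v p.imI ≤ 1 ∧ Valued.v p.imJ ≤ 1 ∧ Valued.v p.imK ≤ 1)
    (hq : Valued.v q.re ≤ 1 ∧ Valued.v q.imI ≤ 1 ∧ Valued.v q.imJ ≤ 1 ∧ Valued.v q.imK ≤ 1) :
    Valued.v (p - q).re ≤ 1 ∧ Valued.v (p - q).imI ≤ 1 ∧ Valued.v (p - q).imJ ≤ 1 ∧
      Valued.v (p - q).imK ≤ 1 := by
  simp only [_root_.QuaternionAlgebra.re_sub, _root_.QuaternionAlgebra.imI_sub,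
    _root_.QuaternionAlgebra.imJ_sub, _root_.QuaternionAlgebra.imK_sub]
  exact ⟨Valuation.map_sub_le _ hp.1 hq.1, Valuation.map_sub_le _ hp.2.1 hq.2.1,
    Valuation.map_sub_le _ hp.2.2.1 hq.2.2.1, Valuation.map_sub_le _ hp.2.2.2 hq.2.2.2⟩

/-! ### Integrality of the diagonal image at almost all places -/

/-- **`ι_w(y) ∈ O_w` for almost all `w`**: the four coordinates of `ι_w(y)` have valuation `≤ 1`
outside a finite set of places (the coordinates of `ι(y)` are finite adeles; Vignéras III §1,
`H_A = ∏' H_w` with respect to the `O_w`). [cite: VignerasLNM800, Ch. III §1 (adèles)] -/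
theorem finite_setOf_not_valued_toAdicCompletion_le (y : ℍ⟮K; 𝓞 K; a, b⟯) :
    {w : HeightOneSpectrum (𝓞 K) | ¬ (Valued.v (toAdicCompletion a b w y).re ≤ 1 ∧
      Valued.v (toAdicCompletion a b w y).imI ≤ 1 ∧ Valued.v (toAdicCompletion a b w y).imJ ≤ 1 ∧
      Valued.v (toAdicCompletion a b w y).imK ≤ 1)}.Finite := by
  have key : ∀ k : K, {w : HeightOneSpectrum (𝓞 K) | ¬ Valued.v (algebraMap K (K_ w) k) ≤ 1}.Finite := by
    intro k
    refine (FiniteAdeleRing.finite_setOf_not_mem (𝓞 K) K (algebraMap K 𝔸ᶠ k)).subset fun w hw => ?_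
    simp only [Set.mem_setOf_eq] at hw ⊢
    rw [HeightOneSpectrum.mem_adicCompletionIntegers, algebraMap_finiteAdele_apply]
    exact hw
  refine ((((key y.re).union (key y.imI)).union (key y.imJ)).union (key y.imK)).subset
    fun w hw => ?_
  simp only [Set.mem_setOf_eq, Set.mem_union, toAdicCompletion_apply] at hw ⊢
  tauto

end QuaternionAlgebra

end Literature.NumberTheory.Automorphic
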